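import Summits.QuantumAdvantage.AdviceFreeQNC0.OutHeavyFacts
import Summits.QuantumAdvantage.AdviceFreeQNC0.OddDualWords
import HarnessLib

/-!
# Cell qa-qnc0 (rung F-Q1, density axis, FAR regime): FENCE L32 — the LP-decoding (pseudocodeword)
# relaxation of R-MI certifies nothing at m ≥ 8

Literature seat qn-lit gen 13, `HOME/qa-qnc0-lit/LIT-MEMO-23.md` §1 (ask L32 of planner qa-qnc0-p1 gen 14:
"is there a printed LP / soft decoder with an ℓ¹ column-test guarantee?").  The relaxed mass inequality
`RelMassIneqAt m K0` (Sketch14, `ColumnTest.lean`) says: for every weight `μ ≥ 0` on the code `C_m`, the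
MINORITY-MASS profile `u ↦ min(p_u, M − p_u)` has at most half of its mass on `Z(K0)`.  LP decoding
[Feldman–Wainwright–Karger 2005; Vontobel–Koetter arXiv:cs/0512078 Def. 10, Lemmas 5–6] replaces "profiles of
weights on codewords" by the FUNDAMENTAL CONE `K(H)` of a family `H` of parity checks: `ω ≥ 0` with
`ω_i ≤ Σ_{j ∈ h ∖ i} ω_j` for all `h ∈ H`, `i ∈ h`; the error pattern `Z` is LP-correctable iff every
pseudocodeword has at most (strictly: less than) half of its mass on `Z`.  This file proves:

* `Pseudocodeword.IsDualWord m h` (`h` meets every codeword of `C_m` evenly), `InCone H ω`, `LPCorrectable H K0`;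
* **Lemma A** `minority_inCone`: the minority-mass profile of ANY weight on `C_m` lies in the fundamental cone
  of ANY family of dual words; hence `relMassIneqAt_of_lpCorrectable : LPCorrectable H K0 → RelMassIneqAt m K0`
  — LP-correctability of `Z(K0)` would give R-MI (and one-word MI) for free;
* dual words of `C_m` have weight `≥ 4` (`four_le_card`) and odd ones weight `≥ 7` (`seven_le_card_of_odd`)
  [from the tree's dual-distance count `two_pow_succ_le_card_of_sum_lowDeg_eq_zero`];
* **Lemma B** `omegaStar_inCone`: for every codeword `K0` the vector `ω* = 1` on `supp K0`, `6` on `Z(K0)` lies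
  in the fundamental cone of ALL dual words; so `not_lpCorrectable`: `7·failCount K0 > 2^m` ⇒ `Z(K0)` is NOT
  LP-correctable for ANY family of dual words — in particular at every optimal `K0` of `C_8`
  (`not_lpCorrectable_eight`, 7·45 > 256) and of `C_15` (`not_lpCorrectable_fifteen`, 7·8736 > 32768);
* `relMI_beyond_lp_eight`: at `m = 8` R-MI HOLDS (`starCert_of_isOpt1_eight` + `relMIOfStar`) although the LP
  relaxation fails — the converse of Lemma A's corollary is false; first-level LP decoding (any redundant
  parity-check matrix, dual witnesses, hyperflows) cannot be the certificate for the far regime.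

Numerics (not formalised): at `m = 7` (`7·16 < 128`) the S₇-symmetrised cone LP with checks of weight 4, 6, 7 has
optimum 0 and prints a dual certificate (`HOME/qa-qnc0-lit/l32/`).  WHAT THIS IS NOT: nothing on `MassIneqAll`,
`CertFifteen`, `TransportFifteen` (OPEN); separation NOT moved; α untouched.
-/

namespace Summit.QuantumAdvantage.AdviceFreeQNC0

open Finset
open Literature.Computability.MetaComplexity Literature.Computability.MetaComplexity.Smolensky
open MassInequality

namespace Pseudocodeword

variable {m : ℕ}

/-! ### Vocabulary -/

/-- `h ⊆ {0,1}^m` is a DUAL WORD of `C_m`: it meets the support of every codeword in an even number of points. -/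
def IsDualWord (m : ℕ) (h : Finset (Fin m → Bool)) : Prop :=
  ∀ X, IsElim1 m X → (h.filter fun u => X u = true).card % 2 = 0

/-- `ω` lies in the FUNDAMENTAL CONE of the check family `H` [Vontobel–Koetter arXiv:cs/0512078, Lemma 5/6]:
`ω ≥ 0` and `ω_i ≤ Σ_{j ∈ h ∖ i} ω_j` for every `h ∈ H` and `i ∈ h`. -/
def InCone (H : Finset (Fin m → Bool) → Prop) (ω : (Fin m → Bool) → ℚ) : Prop :=
  (∀ u, 0 ≤ ω u) ∧ ∀ h, H h → ∀ i ∈ h, ω i ≤ ∑ j ∈ h.erase i, ω j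

/-- The error pattern `Z(K0) = {K0 = false}` is LP-CORRECTABLE with respect to the checks `H` (non-strict form):
every pseudocodeword carries at most half of its mass on `Z(K0)`. -/
def LPCorrectable (H : Finset (Fin m → Bool) → Prop) (K0 : (Fin m → Bool) → Bool) : Prop :=
  ∀ ω, InCone H ω →
    (∑ z ∈ univ.filter (fun z : Fin m → Bool => K0 z = false), ω z) ≤
      ∑ u ∈ univ.filter (fun u : Fin m → Bool => K0 u = true), ω u

/-- Fewer checks, bigger cone: LP-correctability is monotone in the check family. -/
theorem lpCorrectable_mono {H H' : Finset (Fin m → Bool) → Prop} (hHH : ∀ h, H h → H' h)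
    {K0 : (Fin m → Bool) → Bool} (hK : LPCorrectable H K0) : LPCorrectable H' K0 :=
  fun ω hω => hK ω ⟨hω.1, fun h hh i hi => hω.2 h (hHH h hh) i hi⟩

/-! ### Lemma A: minority-mass profiles are pseudocodewords -/

/-- `μ`-mass of the codewords disagreeing with the bit `b` at `j`. -/
theorem mass_ne (μ : ((Fin m → Bool) → Bool) → ℚ) (j : Fin m → Bool) (b : Bool) :
    (∑ X, μ X * (if X j ≠ b then (1 : ℚ) else 0)) = if b then (∑ X, μ X) - freq μ j else freq μ j := by
  unfold freq
  cases b
  · simp only [Bool.false_eq_true, if_false]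
    refine sum_congr rfl fun X _ => ?_
    cases X j <;> simp [bq]
  · simp only [if_true]
    rw [← sum_sub_distrib]
    refine sum_congr rfl fun X _ => ?_
    cases X j <;> simp [bq]

/-- The minority mass at `j` is at most the mass disagreeing with ANY bit `b`. -/
theorem min_le_mass_ne (μ : ((Fin m → Bool) → Bool) → ℚ) (j : Fin m → Bool) (b : Bool) :
    min (freq μ j) ((∑ X, μ X) - freq μ j) ≤ ∑ X, μ X * (if X j ≠ b then (1 : ℚ) else 0) := by
  rw [mass_ne]
  cases b
  · exact min_le_left _ _
  · exact min_le_right _ _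

/-- The majority bit at `j`. -/
def maj (μ : ((Fin m → Bool) → Bool) → ℚ) (j : Fin m → Bool) : Bool := decide ((∑ X, μ X) < 2 * freq μ j)

/-- The mass disagreeing with the majority bit IS the minority mass. -/
theorem mass_ne_maj (μ : ((Fin m → Bool) → Bool) → ℚ) (j : Fin m → Bool) :
    (∑ X, μ X * (if X j ≠ maj μ j then (1 : ℚ) else 0)) = min (freq μ j) ((∑ X, μ X) - freq μ j) := by
  rw [mass_ne]
  unfold maj
  by_cases h : (∑ X, μ X) < 2 * freq μ j
  · rw [decide_eq_true h, if_pos rfl, min_eq_right (by linarith)]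
  · rw [decide_eq_false h]; simp only [Bool.false_eq_true, if_false]; rw [min_eq_left (by linarith)]

/-- Parity forcing: on a dual word `h ∋ i`, a codeword that agrees with the bits `b` off `i` has a determined
value at `i`, namely the parity `c` of `#{j ∈ h ∖ i : b j}`. -/
theorem forced_of_agree {h : Finset (Fin m → Bool)} (hh : IsDualWord m h) {i : Fin m → Bool} (hi : i ∈ h)
    {X : (Fin m → Bool) → Bool} (hX : IsElim1 m X) (b : (Fin m → Bool) → Bool)
    (hagree : ∀ j ∈ h.erase i, X j = b j) :
    X i = decide (((h.erase i).filter fun j => b j = true).card % 2 = 1) := by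
  have hev := hh X hX
  have hsplit : (h.filter fun u => X u = true).card =
      (if X i = true then 1 else 0) + ((h.erase i).filter fun j => b j = true).card := by
    rw [card_filter, card_filter, ← Finset.add_sum_erase h _ hi]
    congr 1
    exact sum_congr rfl fun j hj => by rw [hagree j hj]
  rw [hsplit] at hev
  cases hXi : X i
  · rw [hXi] at hev; simp only [Bool.false_eq_true, if_false, zero_add] at hev
    symm; rw [decide_eq_false_iff_not]; omega
  · rw [hXi] at hev; simp only [if_true] at hev
    symm; rw [decide_eq_true_iff]; omega

/-- Pointwise: disagreement with the forced bit at `i` implies disagreement with `b` somewhere on `h ∖ i`. -/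
theorem indicator_le_sum {h : Finset (Fin m → Bool)} (hh : IsDualWord m h) {i : Fin m → Bool} (hi : i ∈ h)
    {X : (Fin m → Bool) → Bool} (hX : IsElim1 m X) (b : (Fin m → Bool) → Bool) :
    (if X i ≠ decide (((h.erase i).filter fun j => b j = true).card % 2 = 1) then (1 : ℚ) else 0) ≤
      ∑ j ∈ h.erase i, (if X j ≠ b j then (1 : ℚ) else 0) := by
  by_cases hall : ∀ j ∈ h.erase i, X j = b j
  · rw [if_neg (by rw [forced_of_agree hh hi hX b hall]; simp)]
    exact sum_nonneg fun j _ => by split_ifs <;> norm_num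
  · push Not at hall
    obtain ⟨j, hj, hne⟩ := hall
    calc (if X i ≠ decide (((h.erase i).filter fun j => b j = true).card % 2 = 1) then (1 : ℚ) else 0)
        ≤ 1 := by split_ifs <;> norm_num
      _ = (if X j ≠ b j then (1 : ℚ) else 0) := by rw [if_pos hne]
      _ ≤ ∑ j ∈ h.erase i, (if X j ≠ b j then (1 : ℚ) else 0) :=
          single_le_sum (f := fun j => if X j ≠ b j then (1 : ℚ) else 0)
            (fun j _ => by split_ifs <;> norm_num) hj

/-- **Lemma A.**  The minority-mass profile `u ↦ min(p_u, M − p_u)` of every weight `μ ≥ 0` supported on `C_m`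
lies in the fundamental cone of every family of dual words of `C_m`. -/
theorem minority_inCone {H : Finset (Fin m → Bool) → Prop} (hH : ∀ h, H h → IsDualWord m h)
    (μ : ((Fin m → Bool) → Bool) → ℚ) (hμ0 : ∀ X, 0 ≤ μ X) (hμC : ∀ X, μ X ≠ 0 → IsElim1 m X) :
    InCone H fun u => min (freq μ u) ((∑ X, μ X) - freq μ u) := by
  classical
  refine ⟨fun u => ?_, fun h hh i hi => ?_⟩
  · have h1 : 0 ≤ freq μ u := sum_nonneg fun X _ => mul_nonneg (hμ0 X) (by unfold bq; split_ifs <;> norm_num)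
    have h2 : freq μ u ≤ ∑ X, μ X := by
      unfold freq
      exact sum_le_sum fun X _ => by
        have := hμ0 X
        cases X u
        · simp [bq]; linarith
        · simp [bq]
    exact le_min h1 (by linarith)
  · set b := maj μ with hb
    set c : Bool := decide (((h.erase i).filter fun j => b j = true).card % 2 = 1) with hc
    calc min (freq μ i) ((∑ X, μ X) - freq μ i)
        ≤ ∑ X, μ X * (if X i ≠ c then (1 : ℚ) else 0) := min_le_mass_ne μ i c
      _ ≤ ∑ X, μ X * ∑ j ∈ h.erase i, (if X j ≠ b j then (1 : ℚ) else 0) := by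
          refine sum_le_sum fun X _ => ?_
          by_cases hX0 : μ X = 0
          · rw [hX0, zero_mul, zero_mul]
          · exact mul_le_mul_of_nonneg_left (indicator_le_sum (hH h hh) hi (hμC X hX0) b) (hμ0 X)
      _ = ∑ j ∈ h.erase i, ∑ X, μ X * (if X j ≠ b j then (1 : ℚ) else 0) := by
          rw [sum_comm]; exact sum_congr rfl fun X _ => by rw [mul_sum]
      _ = ∑ j ∈ h.erase i, min (freq μ j) ((∑ X, μ X) - freq μ j) :=
          sum_congr rfl fun j _ => by rw [hb]; exact mass_ne_maj μ j

/-- **LP-correctability ⇒ R-MI.**  If `Z(K0)` is LP-correctable with respect to some family of dual words of `C_m`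
then the relaxed mass inequality holds at `K0` (hence ONE-WORD MI, by `oneWordOfRelMI` + `oneWordDecode`). -/
theorem relMassIneqAt_of_lpCorrectable {H : Finset (Fin m → Bool) → Prop} (hH : ∀ h, H h → IsDualWord m h)
    {K0 : (Fin m → Bool) → Bool} (hK : LPCorrectable H K0) : RelMassIneqAt m K0 :=
  fun μ hμ0 hμC => hK _ (minority_inCone hH μ hμ0 hμC)

/-- … and ONE-WORD MI at `K0`. -/
theorem oneWordMIAt_of_lpCorrectable {H : Finset (Fin m → Bool) → Prop} (hH : ∀ h, H h → IsDualWord m h)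
    {K0 : (Fin m → Bool) → Bool} (hK : LPCorrectable H K0) : OneWordMIAt m K0 :=
  oneWordOfRelMI m K0 (oneWordDecode m) (relMassIneqAt_of_lpCorrectable hH hK)

/-! ### Dual words of `C_m` are heavy: weight ≥ 4, odd weight ≥ 7 -/

/-- The codeword "`T` on the classes `≠ r`, `0` on class `r`" for a Boolean `T` of degree `≤ 1`. -/
theorem isElim1_offClass {T : (Fin m → Bool) → Bool} (hT : HasDeg T 1) (r : ℕ) (hr : r < 3) :
    IsElim1 m fun u => if wt u % 3 = r then false else T u := by
  refine ⟨fun s => if s = r then (fun _ => false) else T, fun s => ?_, fun u => ?_, fun u => ?_⟩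
  · by_cases hs : s = r
    · simp only [hs, if_true]; exact hasDeg_false 1
    · simp only [hs, if_false]; exact hT
  · interval_cases r <;> (cases hTu : T u <;> simp [hTu])
  · by_cases hu : wt u % 3 = r
    · simp [hu]
    · simp [hu]

/-- The part of a dual word off class `r` annihilates every polynomial of degree `≤ 1`. -/
theorem sum_offClass_eq_zero {h : Finset (Fin m → Bool)} (hh : IsDualWord m h) (r : ℕ) (hr : r < 3)
    (g : CubeFn (ZMod 2) m) (hg : g ∈ lowDeg (ZMod 2) m 1) :
    ∑ u ∈ h.filter (fun u => wt u % 3 ≠ r), g u = 0 := by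
  classical
  have h01 : ∀ x : ZMod 2, x = 0 ∨ x = 1 := by decide
  -- the Boolean form of `g`
  set T : (Fin m → Bool) → Bool := fun u => decide (g u = 1) with hTdef
  have hTg : ∀ u, (if T u = true then (1 : ZMod 2) else 0) = g u := by
    intro u
    rcases h01 (g u) with h0 | h1
    · have hTu : T u = false := by simp [hTdef, h0]
      rw [hTu, h0]; simp
    · have hTu : T u = true := by simp [hTdef, h1]
      rw [hTu, h1]; simp
  have hT : HasDeg T 1 := by
    unfold HasDeg
    have : (fun x => if T x = true then (1 : ZMod 2) else 0) = g := funext hTg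
    rw [this]; exact hg
  have hev := hh _ (isElim1_offClass hT r hr)
  -- the codeword's support inside `h` is the `T`-part of `h ∖ class r`
  have hset : (h.filter fun u => (if wt u % 3 = r then false else T u) = true) =
      (h.filter fun u => wt u % 3 ≠ r).filter fun u => T u = true := by
    rw [filter_filter]
    refine filter_congr fun u _ => ?_
    by_cases hu : wt u % 3 = r <;> simp [hu]
  rw [hset] at hev
  calc ∑ u ∈ h.filter (fun u => wt u % 3 ≠ r), g u
      = ∑ u ∈ h.filter (fun u => wt u % 3 ≠ r), (if T u = true then (1 : ZMod 2) else 0) :=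
        sum_congr rfl fun u _ => (hTg u).symm
    _ = ((((h.filter fun u => wt u % 3 ≠ r).filter fun u => T u = true).card : ℕ) : ZMod 2) := by
        rw [sum_ite, sum_const_zero, add_zero, sum_const, nsmul_eq_mul, mul_one]
    _ = 0 := by
        rw [ZMod.natCast_eq_zero_iff_even, Nat.even_iff]; exact hev

/-- A nonempty off-class part of a dual word has at least `4` points (dual distance of `RM(1,m)`). -/
theorem four_le_card_offClass {h : Finset (Fin m → Bool)} (hh : IsDualWord m h) (r : ℕ) (hr : r < 3)
    (hne : (h.filter fun u => wt u % 3 ≠ r).Nonempty) : 4 ≤ (h.filter fun u => wt u % 3 ≠ r).card := by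
  have h4 := two_pow_succ_le_card_of_sum_lowDeg_eq_zero 1 _ hne (fun g hg => sum_offClass_eq_zero hh r hr g hg)
  simpa using h4

/-- **Dual words of `C_m` have weight `≥ 4`.** -/
theorem four_le_card {h : Finset (Fin m → Bool)} (hh : IsDualWord m h) (hne : h.Nonempty) : 4 ≤ h.card := by
  obtain ⟨u, hu⟩ := hne
  -- a class different from `u`'s
  set r := (wt u % 3 + 1) % 3 with hr
  have hr3 : r < 3 := Nat.mod_lt _ (by norm_num)
  have hur : wt u % 3 ≠ r := by rw [hr]; omega
  have hmem : u ∈ h.filter fun v => wt v % 3 ≠ r := mem_filter.2 ⟨hu, hur⟩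
  exact (four_le_card_offClass hh r hr3 ⟨u, hmem⟩).trans (card_le_card (filter_subset _ _))

/-- Each class part of an ODD dual word is odd (test with the constant codewords). -/
theorem class_card_odd {h : Finset (Fin m → Bool)} (hh : IsDualWord m h) (hodd : h.card % 2 = 1)
    (r : ℕ) (hr : r < 3) : (h.filter fun u => wt u % 3 = r).card % 2 = 1 := by
  classical
  -- the off-class part is even: test with `T = 1`
  have hT : HasDeg (fun _ : Fin m → Bool => true) 1 := by
    unfold HasDeg
    have : (fun _ : Fin m → Bool => if true = true then (1 : ZMod 2) else 0) = mono (ZMod 2) (∅ : Finset (Fin m)) := by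
      rw [mono_empty]; funext u; simp
    rw [this]; exact mono_mem_lowDeg (by simp)
  have hev := hh _ (isElim1_offClass hT r hr)
  have hset : (h.filter fun u => (if wt u % 3 = r then false else true) = true) = h.filter fun u => wt u % 3 ≠ r := by
    refine filter_congr fun u _ => ?_
    by_cases hu : wt u % 3 = r <;> simp [hu]
  rw [hset] at hev
  have hsum := Finset.card_filter_add_card_filter_not (s := h) (fun u => wt u % 3 = r)
  simp only [ne_eq] at hev
  omega

/-- **Odd dual words of `C_m` have weight `≥ 7`**: each class part is odd, hence nonempty, so each of the three
off-class parts has `≥ 4` points and they cover `h` twice (`≥ 12`), and `|h|` is odd. -/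
theorem seven_le_card_of_odd {h : Finset (Fin m → Bool)} (hh : IsDualWord m h) (hodd : h.card % 2 = 1) :
    7 ≤ h.card := by
  classical
  have hne : ∀ r < 3, (h.filter fun u => wt u % 3 ≠ r).Nonempty := by
    intro r hr
    -- the class `r' = (r+1) % 3 ≠ r` has an odd, hence nonzero, number of points of `h`
    set r' := (r + 1) % 3 with hr'
    have hr'3 : r' < 3 := Nat.mod_lt _ (by norm_num)
    have hrr' : r' ≠ r := by rw [hr']; omega
    have hodd' := class_card_odd hh hodd r' hr'3
    have hpos : 0 < (h.filter fun u => wt u % 3 = r').card := by omega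
    obtain ⟨u, hu⟩ := card_pos.1 hpos
    refine ⟨u, mem_filter.2 ⟨(mem_filter.1 hu).1, ?_⟩⟩
    rw [(mem_filter.1 hu).2]; exact hrr'
  have h0 := four_le_card_offClass hh 0 (by norm_num) (hne 0 (by norm_num))
  have h1 := four_le_card_offClass hh 1 (by norm_num) (hne 1 (by norm_num))
  have h2 := four_le_card_offClass hh 2 (by norm_num) (hne 2 (by norm_num))
  have hsum := OddDualWords.sum_card_filter_ne h
  omega

/-! ### Lemma B: the universal violator `ω* = 1_Out + 6·1_Z` -/

/-- `ω*`: `1` on `supp K0`, `6` on `Z(K0)`. -/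
def omegaStar (K0 : (Fin m → Bool) → Bool) (u : Fin m → Bool) : ℚ := if K0 u = true then 1 else 6

/-- **Lemma B.**  For every codeword `K0`, `ω*` lies in the fundamental cone of ALL dual words of `C_m`. -/
theorem omegaStar_inCone {K0 : (Fin m → Bool) → Bool} (hK0 : IsElim1 m K0) : InCone (IsDualWord m) (omegaStar K0) := by
  classical
  refine ⟨fun u => by unfold omegaStar; split_ifs <;> norm_num, fun h hh i hi => ?_⟩
  have hge1 : ∀ j, (1 : ℚ) ≤ omegaStar K0 j := fun j => by unfold omegaStar; split_ifs <;> norm_num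
  have hcard_le : ∀ s : Finset (Fin m → Bool), (s.card : ℚ) ≤ ∑ j ∈ s, omegaStar K0 j := fun s => by
    have := sum_le_sum fun j (_ : j ∈ s) => hge1 j
    simpa using this
  have h4 : 4 ≤ h.card := four_le_card hh ⟨i, hi⟩
  have herase : (h.erase i).card = h.card - 1 := card_erase_of_mem hi
  by_cases hKi : K0 i = true
  · -- outside point: `1 ≤ |h ∖ i| ≤ Σ`
    have : omegaStar K0 i = 1 := by unfold omegaStar; rw [if_pos hKi]
    rw [this]
    refine le_trans ?_ (hcard_le _)
    have : 3 ≤ (h.erase i).card := by omega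
    exact_mod_cast le_trans (by norm_num : 1 ≤ 3) this
  · have hωi : omegaStar K0 i = 6 := by unfold omegaStar; rw [if_neg hKi]
    rw [hωi]
    by_cases hZ : ∃ j ∈ h.erase i, K0 j = false
    · -- another inside point carries `6`
      obtain ⟨j, hj, hKj⟩ := hZ
      have hωj : omegaStar K0 j = 6 := by unfold omegaStar; rw [hKj]; simp
      calc (6 : ℚ) = omegaStar K0 j := hωj.symm
        _ ≤ ∑ j ∈ h.erase i, omegaStar K0 j :=
            single_le_sum (f := omegaStar K0) (fun k _ => by unfold omegaStar; split_ifs <;> norm_num) hj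
    · -- `h ∩ Z = {i}`: then `|h ∩ supp K0| = |h| − 1` is even, `|h|` is odd, `|h| ≥ 7`
      push Not at hZ
      have hsupp : (h.filter fun u => K0 u = true) = h.erase i := by
        ext u
        simp only [mem_filter, mem_erase]
        constructor
        · rintro ⟨hu, hKu⟩
          refine ⟨fun hui => hKi (hui ▸ hKu), hu⟩
        · rintro ⟨hui, hu⟩
          have := hZ u (mem_erase.2 ⟨hui, hu⟩)
          exact ⟨hu, by cases hK : K0 u <;> simp_all⟩
      have hev := hh K0 hK0
      rw [hsupp, herase] at hev
      have hodd : h.card % 2 = 1 := by omega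
      have h7 := seven_le_card_of_odd hh hodd
      refine le_trans ?_ (hcard_le _)
      rw [herase]
      have : 6 ≤ h.card - 1 := by omega
      exact_mod_cast this

/-- The mass of `ω*`: `Σ_Z ω* = 6·failCount K0`, `Σ_Out ω* = 2^m − failCount K0`. -/
theorem omegaStar_sums (K0 : (Fin m → Bool) → Bool) :
    (∑ z ∈ univ.filter (fun z : Fin m → Bool => K0 z = false), omegaStar K0 z) = 6 * (failCount K0 : ℚ) ∧
    (∑ u ∈ univ.filter (fun u : Fin m → Bool => K0 u = true), omegaStar K0 u) = (2 : ℚ) ^ m - failCount K0 := by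
  classical
  constructor
  · rw [sum_congr rfl fun z hz => by
      show omegaStar K0 z = 6
      unfold omegaStar; rw [(mem_filter.1 hz).2]; simp]
    rw [sum_const, nsmul_eq_mul, mul_comm]; rfl
  · rw [sum_congr rfl fun u hu => by
      show omegaStar K0 u = 1
      unfold omegaStar; rw [if_pos (mem_filter.1 hu).2]]
    rw [sum_const, nsmul_eq_mul, mul_one]
    have hpart := Finset.card_filter_add_card_filter_not (s := (univ : Finset (Fin m → Bool))) (fun u => K0 u = true)
    have hnot : (univ.filter fun u : Fin m → Bool => ¬ K0 u = true) = univ.filter fun u => K0 u = false := by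
      refine filter_congr fun u _ => ?_; simp
    rw [hnot, card_univ, Fintype.card_fun, Fintype.card_bool, Fintype.card_fin] at hpart
    unfold failCount
    have h' : ((univ.filter fun u : Fin m → Bool => K0 u = true).card : ℚ) +
        ((univ.filter fun u : Fin m → Bool => K0 u = false).card : ℚ) = (2 : ℚ) ^ m := by exact_mod_cast hpart
    linarith

/-- **FENCE L32.**  If `7·failCount K0 > 2^m` then `Z(K0)` is not LP-correctable with respect to ANY family of
dual words of `C_m` (the pseudocodeword `ω*` violates the mass condition). -/
theorem not_lpCorrectable {H : Finset (Fin m → Bool) → Prop} (hH : ∀ h, H h → IsDualWord m h)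
    {K0 : (Fin m → Bool) → Bool} (hK0 : IsElim1 m K0) (h7 : 2 ^ m < 7 * failCount K0) : ¬ LPCorrectable H K0 := by
  intro hLP
  have hcone : InCone H (omegaStar K0) :=
    ⟨(omegaStar_inCone hK0).1, fun h hh i hi => (omegaStar_inCone hK0).2 h (hH h hh) i hi⟩
  have h := hLP _ hcone
  obtain ⟨hZ, hO⟩ := omegaStar_sums K0
  rw [hZ, hO] at h
  have h7' : (2 : ℚ) ^ m < 7 * failCount K0 := by exact_mod_cast h7
  linarith

/-- **m = 8**: at every optimal codeword of `C_8` (`failCount = 45`, `7·45 = 315 > 256`) the zero set is not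
LP-correctable for any family of dual words. -/
theorem not_lpCorrectable_eight {H : Finset (Fin 8 → Bool) → Prop} (hH : ∀ h, H h → IsDualWord 8 h)
    {K0 : (Fin 8 → Bool) → Bool} (hK : IsOpt1 8 K0) : ¬ LPCorrectable H K0 :=
  not_lpCorrectable hH hK.1 (by rw [failCount_of_isOpt1_eight hK]; norm_num)

/-- **m = 15**: at the (unique, `SymCount.opt_fifteen`) optimal codeword of `C_15` (`failCount = 8736`,
`7·8736 = 61152 > 32768`) the zero set is not LP-correctable for any family of dual words — the LP-decoding
relaxation cannot be the certificate for R-MI(15) / `TransportFifteen`. -/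
theorem not_lpCorrectable_fifteen {H : Finset (Fin 15 → Bool) → Prop} (hH : ∀ h, H h → IsDualWord 15 h)
    {K0 : (Fin 15 → Bool) → Bool} (hK : IsOpt1 15 K0) : ¬ LPCorrectable H K0 := by
  obtain rfl : K0 = SymCount.symWord 15 false := SymCount.opt_fifteen hK
  exact not_lpCorrectable hH hK.1 (by rw [SymCount.failCount_symWord_fifteen]; norm_num)

/-- **R-MI is strictly weaker than LP-correctability**: at every optimal `K0` of `C_8` the relaxed mass inequality
HOLDS (kernel: `starCert_of_isOpt1_eight`, `relMIOfStar`) while `Z(K0)` is not LP-correctable even for the full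
dual code.  The far-regime certificates must use that minority profiles come from distributions on codewords. -/
theorem relMI_beyond_lp_eight {K0 : (Fin 8 → Bool) → Bool} (hK : IsOpt1 8 K0) :
    RelMassIneqAt 8 K0 ∧ ¬ LPCorrectable (IsDualWord 8) K0 :=
  ⟨relMIOfStar 8 K0 (starCert_of_isOpt1_eight hK), not_lpCorrectable_eight (fun _ hh => hh) hK⟩

end Pseudocodeword

end Summit.QuantumAdvantage.AdviceFreeQNC0
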